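import Summits.BirchSwinnertonDyer.Uniform.U2.TransportARankZero
import Literature.NumberTheory.EllipticCurves.BoxerDiao2010.TwoSelmerTwists
import HarnessLib

/-!
# Track U2, route A (cell `bsd-uniform`, seat u2-p1): the ZHAI–BOXER–DIAO FAMILY — `BSD(E^{(M)}, 2)`
# OUTRIGHT for the a_q-odd twists of a "good" rank-`0` curve, every input PRINTED

HONEST FRAMING (cell `bsd-uniform`, HOME run/shared/lean/pub/bsd-uniform/, verbatim in every file of
the seat): a RELATIVE (twist-transport) theorem, uniform in the twisting parameter `M`, anchored on a
base curve `E` satisfying CLASS-LEVEL printed hypotheses plus ONE per-base datum (`Sel₂(E/ℚ) = 0`,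
inside Boxer–Diao's "good") and Zhai's unit `2`-adic `L`-value. It is the kernel-checked form of a
statement that IS IN PRINT as a remark: Zhai 2016, after Thm 1.1 (arXiv:1409.0231 chunk p0002 L31):
"by the above theorem and the work of Boxer and Diao [Boxer], the 2-part of Birch and Swinnerton-Dyer
conjecture is valid for `L(E^{(M)},s)`, with `M = ε q₁q₂⋯q_r ≡ 1 mod 4` … and `E` … satisfying the
conditions in Theorem 1.1 and the following further conditions: 1) The 2-Selmer rank of `E` is 0;
2) If `p` is any prime for which `E` has bad reduction, then `E` has multiplicative reduction at `p`
and the `p`-adic valuation of the discriminant of `E` is odd; 3) `E` has good reduction at 2 and the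
reduction of `E mod 2` has `j`-invariant 0." NOVELTY: NONE claimed — this file makes a printed remark
a theorem of the tree from its three printed ingredients taken BY NAME (Zhai 2016 Thm 1.1 =
`Zhai2016.thm11_…`; Boxer–Diao 2010 Thm 1.1 = `BoxerDiao2010.thm11_sel2_twist`; Boxer–Diao Prop 4.1 =
`BoxerDiao2010.prop41_tamagawa_twist`) plus modularity, through route A's kernel
(`rank_eq_zero_and_sha_two_eq_bot_of_card_selmerGroup_two_eq_one`: `Sel₂ = 0 ⇒ Ш[2^∞] = 0`, the step
Zhai's remark leaves to the reader) and the p2 lane's count form. It converts PAIRS (an explicit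
infinite family of analytic-rank-`0` twists), never the class X5; books nothing by itself; the referee
decides any CONVERSIONS row. Unlike `TransportARankZero` (Mazur–Rubin control: `M ≡ 1 (mod 8)`, split
conditions at bad primes) this family allows EVERY odd square-free `M ≡ 1 (mod 4)` prime to `Δ` with
2-trivial prime factors, on Boxer–Diao's "good" bases (square-free odd-`ord(Δ)` conductor, `Δ < 0`,
minimal model `y² + y = x³ + …`).

DICTIONARY NOTE (INGREDIENTS.md F9): the twisting primes carry the SAME condition in two printed
dialects, both kept as binders because the tree does not yet prove their equivalence: Zhai's "`q` inert
in the cubic field `F` of the `2`-division polynomial" (`Zhai2016.IsInertIn F q`) and Boxer–Diao's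
"`E` has no rational `2`-torsion mod `q`" (`BoxerDiao2010.IsTwoTrivial`); both say `a_q(E)` is odd.

## Contents
* `natCard_twoTorsionSubtype_eq_one_of_torsionBy_eq_bot` — bookkeeping `E(ℚ)[2] = ⊥ ⇒ #{P : 2P = 0} = 1`.
* `bsdp_two_twist_of_zhai11_boxerDiao` — THE FAMILY THEOREM: `r_an(E^{(M)}) = 0`, `rank E^{(M)} = 0`,
  `Ш(E^{(M)}/ℚ)[2^∞] = 0`, `∏ c_ℓ(E^{(M)})` odd, and `BSD(E^{(M)}, 2)`.

References: S. Zhai, Asian J. Math. 20 (2016) Thm 1.1 and the remark after it [Zhai2016]; G. Boxer,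
P. Diao, Proc. AMS 138 (2010) Thm 1.1, Prop 4.1 [BoxerDiao2010]; Miller 2011 Def 1.1 [Miller2011LMS];
p2 lane `P2/CountsAtTwoZhai16.lean`.
-/

noncomputable section

open scoped Classical AddSubgroup

open NumberField WeierstrassCurve Literature.NumberTheory.EllipticCurves
  Literature.NumberTheory.EllipticCurves.ModularForms
  Literature.NumberTheory.EllipticCurves.Rank1Residual
  Literature.NumberTheory.EllipticCurves.CoatesLiTianZhai2015
  Literature.NumberTheory.EllipticCurves.Zhai2016
  Summit.BirchSwinnertonDyer.Rank1Residual

namespace Summit.BirchSwinnertonDyer.Uniform.U2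

/-- `A[2] = ⊥ ⇒ #{P : A // 2 • P = 0} = 1` (the subtype is `{0}`). [folklore] -/
theorem natCard_twoTorsionSubtype_eq_one_of_torsionBy_eq_bot {A : Type*} [AddCommGroup A]
    (h : A[(2 : ℤ)] = ⊥) : Nat.card {P : A // (2 : ℕ) • P = 0} = 1 := by
  have h' := torsionBy_two_eq_bot_iff.mp h
  rw [Nat.card_eq_one_iff_unique]
  exact ⟨⟨fun a b => Subtype.ext ((h' a.1 a.2).trans (h' b.1 b.2).symm)⟩, ⟨⟨0, by simp⟩⟩⟩

section Family

variable {W : WeierstrassCurve ℚ} [W.IsElliptic] [W.IsGloballyMinimal] [NeZero (W.conductorNorm ℤ)]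

/-- **THE ZHAI–BOXER–DIAO FAMILY (Zhai 2016's remark after Thm 1.1, as a theorem).** Let `E/ℚ` be
`Γ₀(N)`-optimal (globally minimal `W`, datum `Dt` with the lattice equality) and "good" in the sense of
Boxer–Diao (`#Sel₂(E/ℚ) = 1`, `Δ < 0`, every bad prime multiplicative with `v_p(Δ)` odd, minimal model
`y² + y = x³ + a₂x² + a₄x + a₆`), with `ord₂(L(E,1)/Ω_∞(E)) = 0`; let `F` be the cubic `2`-division
field; let `M` be square-free, `M ≡ 1 (mod 4)`, prime to `N` and to `Δ`, with `r ≥ 1` prime factors,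
all odd, inert in `F` (Zhai) and with no rational `2`-torsion of `E` mod `q` (Boxer–Diao: `M` is
2-trivial — the same condition, INGREDIENTS F9); `WM` a globally minimal model of `E^{(M)}`. THEN
`r_an(E^{(M)}) = 0`, `rank E^{(M)}(ℚ) = 0`, `Ш(E^{(M)}/ℚ)[2^∞] = 0`, `∏_ℓ c_ℓ(E^{(M)})` is odd, and
`BSD(E^{(M)}, 2)` holds (`BSDp WM 2`). Inputs by name: Zhai Thm 1.1 (`h11`), Boxer–Diao Thm 1.1
(`hBD`) and Prop 4.1 (`hBD4`), modularity (`hmod`). No novelty claimed (printed remark).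
[cite: Zhai2016, Thm. 1.1 and the remark after it (arXiv:1409.0231 chunk p0002 L22–L31)]
[cite: BoxerDiao2010, Thm. 1.1 (p. 1971) and Prop. 4.1 (p. 1976)] [cite: Miller2011LMS, Def. 1.1] -/
theorem bsdp_two_twist_of_zhai11_boxerDiao (h11 : thm11_ordTwo_LAlg_twist_eq_zero)
    (hBD : BoxerDiao2010.thm11_sel2_twist) (hBD4 : BoxerDiao2010.prop41_tamagawa_twist)
    (hmod : hasEntireLFunction_rat)
    (Dt : ModularParametrizationData W (W.conductorNorm ℤ)) (hopt : Zhai2021.IsOptimalDatum W Dt)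
    (hgood : BoxerDiao2010.IsGood W)
    (hL : ∃ x : ℚ, IsLAlg W x ∧ x ≠ 0 ∧ padicValRat 2 x = 0)
    (F : Type) [Field F] [NumberField F] (hF : IsTwoDivisionField W F)
    (M : ℤ) (hsq : Squarefree M) (hM4 : M % 4 = 1)
    (hgcdN : Int.gcd M (W.conductorNorm ℤ) = 1) (hgcdΔ : Int.gcd M (minimalDiscriminantInt W) = 1)
    (hne : M.natAbs.primeFactors.Nonempty) (hin : ∀ q ∈ M.natAbs.primeFactors, q ≠ 2 ∧ IsInertIn F q)
    (htriv : BoxerDiao2010.IsTwoTrivial W M)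
    {WM : WeierstrassCurve ℚ} [WM.IsElliptic] [WM.IsGloballyMinimal]
    (hWM : ∃ C : VariableChange ℚ, C • W.quadraticTwist (M : ℚ) = WM) :
    WM.analyticRank = 0 ∧ WM.mordellWeilRank = 0 ∧ AddCommGroup.primaryComponent WM.sha 2 = ⊥ ∧
      Odd WM.tamagawaProduct ∧ BSDp WM 2 := by
  have hsel : Nat.card (W.selmerGroup 2) = 1 := hgood.1
  have hΔ : W.Δ < 0 := hgood.2.1
  -- base: `Sel₂(E) = 0` ⇒ `E(ℚ)[2] = ⊥` ⇒ Zhai's binder `#E(ℚ)[2] = 1`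
  obtain ⟨-, hW2, -⟩ := rank_eq_zero_and_sha_two_eq_bot_of_card_selmerGroup_two_eq_one W hsel
  have h1 : Nat.card {P : W.toAffine.Point // (2 : ℕ) • P = 0} = 1 :=
    natCard_twoTorsionSubtype_eq_one_of_torsionBy_eq_bot hW2
  -- Zhai (analytic side), count form
  obtain ⟨hr, hiff⟩ := P2.bsdp_two_twist_iff_of_zhai11 h11 hmod Dt hopt hΔ h1 hL F hF M hsq hM4
    hgcdN hne hin hWM
  obtain ⟨-, -, -, hfinSha⟩ := h11 W Dt hopt hΔ h1 hL F hF M hsq hM4 hgcdN hne hin WM hWM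
  haveI := hfinSha
  -- Boxer–Diao Thm 1.1 (M odd): `Sel₂(E^{(M)}) = 0`; the kernel: rank 0 and `Ш[2^∞] = 0`
  have hWM' : ∃ C : VariableChange ℚ, C • WM = W.quadraticTwist (M : ℚ) := P2.exists_smul_eq_comm.mp hWM
  have hModd : Odd M := Int.odd_iff.mpr (by omega)
  have hselM : Nat.card (WM.selmerGroup 2) = 1 := (hBD W hgood M hsq htriv hgcdΔ WM hWM').1 hModd
  obtain ⟨hrM, -, hshaM⟩ := rank_eq_zero_and_sha_two_eq_bot_of_card_selmerGroup_two_eq_one WM hselM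
  -- Boxer–Diao Prop 4.1 (1): Tamagawa product odd
  have hc : Odd WM.tamagawaProduct := ((hBD4 W hgood M hsq WM hWM').1 hgcdΔ).mpr htriv
  have hc0 : padicValNat 2 WM.tamagawaProduct = 0 :=
    padicValNat.eq_zero_of_not_dvd (fun h2 => (Nat.not_even_iff_odd.mpr hc) (even_iff_two_dvd.mpr h2))
  refine ⟨hr, hrM, hshaM, hc, hiff.mpr ?_⟩
  rw [padicValNat_card_eq_zero_of_primaryComponent_eq_bot 2 hshaM, hc0]

end Family

end Summit.BirchSwinnertonDyer.Uniform.U2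

end
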